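import Summits.CriticalPhenomena.SAWScalingLimit.Theorems.MassRatio.Negative.Brick

/-!
# Crux `MassRatio` (stmt-CriticalPhenomena-8550) — load-bearing hypotheses, part 2: self-avoiding walks from vertex lists (`mkSAW`), values of `Z = F_{x,0}`, and uniqueness of the walk down a bare root-attached corridor (`verts_eq_corridor`, `norm_Z_corridor_tip`)

Negative knowledge on the crux `MassRatio` (stmt-CriticalPhenomena-8550, route SAWDefectDecoherence r3),
written by the standing disprover (cdisprove, cycles 1–4). The series `MassRatio/Negative/*` does NOT
refute the crux (verdict: RESISTS — it is a pure exponent bet, predicted ratio `δ^{-25/48}` against the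
cut `δ^{-3/4}`); it proves which hypotheses of the crux are LOAD-BEARING (rows clause, `0 < ρ`,
`δ·mid(b_δ) → b`, exhaustion of compacts: each deleted ⇒ FALSE, by explicit admissible families in the
rectangle `D₀ = (-2,2)×(-1,1)` whose boundary mass at the target edge is starved EXACTLY by a bare
corridor), that the hypothesis frame is satisfiable (`massRatio_frame_nonvacuous`), and that the
`Nonempty`-SAW clause is implied by the others. Mechanism throughout: on a bare root-attached corridor
the self-avoiding walk is unique, so `|Z| = x_c^{length}` exactly, while a staircase walk certifies
`|Z(e₀)| ≥ x_c^{2 iK + 1}` at a mid-edge `e₀` of the compact `Kbox`; `x_c < 3/5` and Bernoulli finish.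
-/

namespace Summit.CriticalPhenomena.SAWScalingLimit.Theorems.MassRatio.Negative

open Literature.Probability.LatticeModels Literature.Probability.RandomPlanarGeometry.SAW
open Literature.Probability.RandomPlanarGeometry
open Summit.CriticalPhenomena.SAWScalingLimit.Theses.SAWDefectDecoherence

/-! ### Self-avoiding walks from vertex lists -/

/-- A self-avoiding walk of the domain `Λ` from the mid-edge `s(u, w)` (entered at `w`) to the
mid-edge `z`, built from its nonempty duplicate-free chain of vertices `l` (`u ∉ l`, some endpoint
of `z` off `l`). [folklore] -/
def mkSAW (Λ : Finset HexVertex) (u w : HexVertex) (z : Sym2 HexVertex) (l : List HexVertex)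
    (hl : l ≠ []) (hsub : ∀ v ∈ l, v ∈ Λ) (hnd : l.Nodup) (hch : l.IsChain hexGraph.Adj)
    (hhead : l.head hl = w) (hlast : l.getLast hl ∈ z) (huw : hexGraph.Adj u w) (hw : w ∈ Λ)
    (hu : u ∉ l) (hz : ∃ t ∈ z, t ∉ l) (haz : s(u, w) ≠ z) : HexMidEdgeSAW Λ s(u, w) z where
  verts := l
  subset := hsub
  nodup := hnd
  isChain := hch
  head_mem := by
    intro v hv
    rw [List.head?_eq_some_head hl, Option.some_inj] at hv
    rw [← hv, hhead]; exact Sym2.mem_mk_right _ _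
  getLast_mem := by
    intro v hv
    rw [List.getLast?_eq_some_getLast hl, Option.some_inj] at hv
    rw [← hv]; exact hlast
  eq_of_nil := fun h => (hl h).elim
  edges_nodup := fun _ => by
    have hE := edges_nodup hnd
    have haE : s(u, w) ∉ List.zipWith (fun u w => s(u, w)) l l.tail := fun h =>
      hu (forall_mem_of_mem_edges l _ h u (Sym2.mem_mk_left _ _))
    have hzE : z ∉ List.zipWith (fun u w => s(u, w)) l l.tail := fun h => by
      obtain ⟨t, ht, htl⟩ := hz
      exact htl (forall_mem_of_mem_edges l _ h t ht)
    have hdis : ∀ e ∈ s(u, w) :: List.zipWith (fun u w => s(u, w)) l l.tail, ∀ e' ∈ [z],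
        e ≠ e' := by
      intro e he e' he' hee
      rw [List.mem_singleton] at he'
      rw [he'] at hee
      rw [hee] at he
      rcases List.mem_cons.1 he with h | h
      · exact haz h.symm
      · exact hzE h
    exact List.nodup_append.2 ⟨List.nodup_cons.2 ⟨haE, hE⟩, List.nodup_singleton _, hdis⟩
  fst_mem := ⟨(SimpleGraph.mem_edgeSet _).2 huw, w, Sym2.mem_mk_right _ _, hw⟩

/-- `mkSAW_length`: walk toolkit (`mkSAW`, values of `Z`, bare corridors) (MassRatio negative series). [folklore] -/
@[simp] theorem mkSAW_length (Λ : Finset HexVertex) (u w : HexVertex) (z : Sym2 HexVertex)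
    (l : List HexVertex) (hl hsub hnd hch hhead hlast huw hw hu hz haz) :
    (mkSAW Λ u w z l hl hsub hnd hch hhead hlast huw hw hu hz haz).length = l.length := rfl

/-! ### Values of `Z = F_{x,0}` -/

/-- Every exhibited walk gives the lower bound `x^{ℓ(γ)} ≤ |Z(z)|`. [folklore] -/
theorem pow_length_le_norm_Z (Λ : Finset HexVertex) (a z : Sym2 HexVertex)
    (γ : HexMidEdgeSAW Λ a z) {x : ℝ} (hx : 0 ≤ x) :
    x ^ γ.length ≤ ‖hexParafermionicObservable Λ a x 0 z‖ := by
  rw [hexParafermionicObservable_zero_spin, Complex.norm_real,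
    Real.norm_of_nonneg (Finset.sum_nonneg fun γ _ => pow_nonneg hx _)]
  exact Finset.single_le_sum (fun γ _ => pow_nonneg hx _) (Finset.mem_univ γ)

/-- `|Z(z)| ≥ 0` is a sum of nonnegative reals. [folklore] -/
theorem norm_Z_eq_sum (Λ : Finset HexVertex) (a z : Sym2 HexVertex) {x : ℝ} (hx : 0 ≤ x) :
    ‖hexParafermionicObservable Λ a x 0 z‖ = ∑ γ : HexMidEdgeSAW Λ a z, x ^ γ.length := by
  rw [hexParafermionicObservable_zero_spin, Complex.norm_real,
    Real.norm_of_nonneg (Finset.sum_nonneg fun γ _ => pow_nonneg hx _)]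

/-- If all walks `a → z` coincide with `γ₀`, then `|Z(z)| = x^{ℓ(γ₀)}`. [folklore] -/
theorem norm_Z_eq_of_unique {Λ : Finset HexVertex} {a z : Sym2 HexVertex}
    (γ₀ : HexMidEdgeSAW Λ a z) (h : ∀ γ : HexMidEdgeSAW Λ a z, γ = γ₀) {x : ℝ} (hx : 0 ≤ x) :
    ‖hexParafermionicObservable Λ a x 0 z‖ = x ^ γ₀.length := by
  letI : Unique (HexMidEdgeSAW Λ a z) := ⟨⟨γ₀⟩, h⟩
  rw [hexParafermionicObservable, Fintype.sum_unique, HexMidEdgeSAW.norm_weight _ hx]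
  rfl

/-! ### Bare corridors hanging off the root vertex: the walk to the tip is unique -/

section Corridor

variable {Λ : Finset HexVertex} {u y : HexVertex} {c : ℕ → HexVertex} {L : ℕ}

/-- **Uniqueness of the walk down a bare root-attached corridor.** `c 0` is the root vertex (the
endpoint in `Λ` of the root mid-edge `s(u, c 0)`, `u ∉ Λ`), `c 1, …, c L` a corridor whose only
`Λ`-neighbours are its corridor neighbours (and `c 0` for `c 1`), tip mid-edge `s(c L, y)`,
`y ∉ Λ`. Then every self-avoiding walk from the root to the tip IS the corridor. [folklore] -/
theorem verts_eq_corridor (hu : u ∉ Λ) (hy : y ∉ Λ)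
    (hinj : ∀ i j, i ≤ L → j ≤ L → c i = c j → i = j)
    (hbare : ∀ i, 1 ≤ i → i ≤ L → ∀ v ∈ Λ, hexGraph.Adj (c i) v →
      v = c (i - 1) ∨ (i < L ∧ v = c (i + 1)))
    (haz : s(u, c 0) ≠ s(c L, y))
    (γ : HexMidEdgeSAW Λ s(u, c 0) s(c L, y)) :
    γ.verts = (List.range (L + 1)).map c := by
  set l := γ.verts with hl
  have hne : l ≠ [] := fun h => haz (γ.eq_of_nil h)
  have hn : 0 < l.length := List.length_pos_iff.2 hne
  -- endpoints
  have hmemΛ : ∀ (i : ℕ) (hi : i < l.length), l[i] ∈ Λ := fun i hi => γ.subset _ (List.getElem_mem _)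
  have h0 : l[0] = c 0 := by
    have hmem := γ.head_mem (l.head hne) (List.head?_eq_some_head hne)
    rw [List.head_eq_getElem] at hmem
    rcases Sym2.mem_iff.1 hmem with h | h
    · have hΛ := hmemΛ 0 hn
      rw [h] at hΛ
      exact absurd hΛ hu
    · exact h
  have hlast : l[l.length - 1] = c L := by
    have hmem := γ.getLast_mem (l.getLast hne) (List.getLast?_eq_some_getLast hne)
    rw [List.getLast_eq_getElem] at hmem
    rcases Sym2.mem_iff.1 hmem with h | h
    · exact h
    · have hΛ := hmemΛ (l.length - 1) (by omega)
      rw [h] at hΛ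
      exact absurd hΛ hy
  have hchain : ∀ (i : ℕ) (hi : i + 1 < l.length), hexGraph.Adj l[i] l[i + 1] :=
    fun i hi => List.isChain_iff_getElem.1 γ.isChain i hi
  have hnod : ∀ (i j : ℕ) (hi : i < l.length) (hj : j < l.length), l[i] = l[j] → i = j :=
    fun i j hi hj h => (γ.nodup.getElem_inj_iff).1 h
  -- the case of a one-vertex walk
  by_cases hn1 : l.length = 1
  · have hL : L = 0 := by
      have : c 0 = c L := by rw [← h0, ← hlast]; congr 1; omega
      exact (hinj 0 L (Nat.zero_le _) le_rfl this).symm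
    subst hL
    apply List.ext_getElem (by simp [hn1])
    intro i hi hi'
    have : i = 0 := by omega
    subst this
    simpa using h0
  have hn2 : 2 ≤ l.length := by omega
  -- `L ≥ 1`
  have hL1 : 1 ≤ L := by
    by_contra hL
    have hL0 : L = 0 := by omega
    have : l[l.length - 1] = l[0] := by rw [hlast, h0, hL0]
    have := hnod _ _ (by omega) hn this
    omega
  by_cases h1 : l[1] = c 1
  · -- the walk goes down the corridor
    have claimA : ∀ j (hj : j < l.length), j ≤ L ∧ l[j] = c j := by
      intro j
      induction j using Nat.strong_induction_on with
      | _ j ih =>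
        intro hj
        match j with
        | 0 => exact ⟨Nat.zero_le _, h0⟩
        | 1 => exact ⟨hL1, h1⟩
        | j + 2 =>
          obtain ⟨hjL, hj1⟩ := ih (j + 1) (by omega) (by omega)
          obtain ⟨-, hj0⟩ := ih j (by omega) (by omega)
          have hadj : hexGraph.Adj (c (j + 1)) l[j + 2] := by
            have := hchain (j + 1) (by omega)
            rwa [hj1] at this
          rcases hbare (j + 1) (by omega) hjL _ (hmemΛ _ hj) hadj with h | ⟨hlt, h⟩
          · exfalso
            have : l[j + 2] = l[j] := by rw [h, hj0]; rfl
            have := hnod _ _ hj (by omega) this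
            omega
          · exact ⟨by omega, h⟩
    have hlen : l.length = L + 1 := by
      obtain ⟨hle, heq⟩ := claimA (l.length - 1) (by omega)
      have : c (l.length - 1) = c L := by rw [← heq, hlast]
      have := hinj _ _ hle le_rfl this
      omega
    apply List.ext_getElem (by simp [hlen])
    intro i hi hi'
    simp only [List.getElem_map, List.getElem_range]
    exact (claimA i hi).2
  · -- the walk leaves the corridor at the root: it can never come back
    exfalso
    have claimB : ∀ j, 1 ≤ j → ∀ (hj : j < l.length), ∀ i, 1 ≤ i → i ≤ L → l[j] ≠ c i := by
      intro j hj1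
      induction j with
      | zero => omega
      | succ j ih =>
        intro hj i hi1 hiL heq
        rcases Nat.eq_zero_or_pos j with rfl | hjpos
        · -- `j + 1 = 1`
          have hadj : hexGraph.Adj (c i) (c 0) := by
            have := hchain 0 (by omega)
            rw [h0] at this
            simp only [zero_add] at heq
            rw [heq] at this
            exact this.symm
          have hc0 : c 0 ∈ Λ := by have := hmemΛ 0 hn; rwa [h0] at this
          rcases hbare i hi1 hiL _ hc0 hadj with h | ⟨hlt, h⟩
          · have := hinj 0 (i - 1) (Nat.zero_le _) (by omega) h
            have hi : i = 1 := by omega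
            subst hi
            exact h1 heq
          · have := hinj 0 (i + 1) (Nat.zero_le _) (by omega) h
            omega
        · have hadj : hexGraph.Adj (c i) l[j] := by
            have := hchain j (by omega)
            rw [heq] at this
            exact this.symm
          rcases hbare i hi1 hiL _ (hmemΛ j (by omega)) hadj with h | ⟨hlt, h⟩
          · rcases Nat.eq_zero_or_pos (i - 1) with hi0 | hipos
            · have hi : i = 1 := by omega
              subst hi
              have : l[j] = l[0] := by rw [h, h0]
              have := hnod _ _ (by omega) hn this
              omega
            · exact ih (by omega) (by omega) (i - 1) hipos (by omega) h
          · exact ih (by omega) (by omega) (i + 1) (by omega) (by omega) h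
    exact claimB (l.length - 1) (by omega) (by omega) L hL1 le_rfl hlast

/-- The corridor walk itself. [folklore] -/
def corridorWalk (hcΛ : ∀ i, i ≤ L → c i ∈ Λ)
    (hinj : ∀ i j, i ≤ L → j ≤ L → c i = c j → i = j)
    (hadj : ∀ i, i < L → hexGraph.Adj (c i) (c (i + 1)))
    (huc : hexGraph.Adj u (c 0)) (hu : u ∉ Λ) (hy : y ∉ Λ)
    (haz : s(u, c 0) ≠ s(c L, y)) : HexMidEdgeSAW Λ s(u, c 0) s(c L, y) :=
  mkSAW Λ u (c 0) s(c L, y) ((List.range (L + 1)).map c) (by simp)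
    (by
      intro v hv
      simp only [List.mem_map, List.mem_range] at hv
      obtain ⟨i, hi, rfl⟩ := hv
      exact hcΛ i (by omega))
    (by
      refine List.Nodup.map_on ?_ List.nodup_range
      intro i hi j hj h
      simp only [List.mem_range] at hi hj
      exact hinj i j (by omega) (by omega) h)
    (by
      refine List.isChain_iff_getElem.2 ?_
      intro i hi
      simp only [List.length_map, List.length_range] at hi
      simp only [List.getElem_map, List.getElem_range]
      exact hadj i (by omega))
    (by simp [List.range_succ_eq_map])
    (by
      rw [List.getLast_eq_getElem]
      simp [List.getElem_map, List.getElem_range])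
    huc (hcΛ 0 (Nat.zero_le _))
    (by
      simp only [List.mem_map, List.mem_range, not_exists, not_and]
      intro i hi h
      exact hu (h ▸ hcΛ i (by omega)))
    ⟨y, Sym2.mem_mk_right _ _, by
      simp only [List.mem_map, List.mem_range, not_exists, not_and]
      intro i hi h
      exact hy (h ▸ hcΛ i (by omega))⟩
    haz

/-- **The mass at the tip of a bare root-attached corridor of `L` vertices is exactly `x^{L+1}`.** [folklore] -/
theorem norm_Z_corridor_tip (hcΛ : ∀ i, i ≤ L → c i ∈ Λ)
    (hinj : ∀ i j, i ≤ L → j ≤ L → c i = c j → i = j)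
    (hadj : ∀ i, i < L → hexGraph.Adj (c i) (c (i + 1)))
    (huc : hexGraph.Adj u (c 0)) (hu : u ∉ Λ) (hy : y ∉ Λ)
    (hbare : ∀ i, 1 ≤ i → i ≤ L → ∀ v ∈ Λ, hexGraph.Adj (c i) v →
      v = c (i - 1) ∨ (i < L ∧ v = c (i + 1)))
    (haz : s(u, c 0) ≠ s(c L, y)) {x : ℝ} (hx : 0 ≤ x) :
    ‖hexParafermionicObservable Λ s(u, c 0) x 0 s(c L, y)‖ = x ^ (L + 1) := by
  have h := norm_Z_eq_of_unique (corridorWalk hcΛ hinj hadj huc hu hy haz) (fun γ =>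
    HexMidEdgeSAW.ext (by
      rw [verts_eq_corridor hu hy hinj hbare haz γ]
      rfl)) hx
  rw [h]
  simp [corridorWalk]

end Corridor

end Summit.CriticalPhenomena.SAWScalingLimit.Theorems.MassRatio.Negative
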